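import Summits.ABC.IUTFork.Cor312VolumesPadicLattice
import Literature.IUT.LogVolume.TensorPacketUnramifiedShell
import HarnessLib

/-!
# [IUTchIII] Corollary 3.12, statement — the log-shell lattices of the real prime packets in FIELD-FACTOR
# coordinates: bounded, neighbourhoods of `0` (absorption of bounded Θ-boxes), and the unramified case

Record-only file (D-0012) of the abc-iut cell (Cor. 3.12 sub-crew, seat abc-iut-c312-5, gen 3; D-0067 TEAM A row
A-0, the `ThetaFinite` leftover, real-instance half); TAKES NO SIDE. Companion of `Cor312VolumesPadicLattice`
(the lattices `Π_{v⃗} c·I_{v⃗}` of the real prime packets of a `p`-adic presentation `P`, Dupuy–Hilado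
arXiv:2004.13228 §4 intro "the `ℤ_p`-lattice `I^{⊗ j+1}_{V̲,p} = ⊕_{v⃗} I_{v⃗}`", and their stability under (Ind1),
(Ind2)). Here, in the FIELD-FACTOR coordinates `Π_{(v⃗,i)} L_{v⃗,i}` of abc-iut-c312-3's chosen decompositions
`ψ_{v⃗} : X_{v⃗} ≃ Π_i L_{v⃗,i}` ([IUTchIV] Prop. 1.4 (i): the packet "decomposes … as direct sums of finitely many
finite extensions of `ℚ_p`") — the coordinates in which c312-7's real hull frame reads boundedness and
non-degeneracy (`Cor312SettingReal`, `ofComparison_hullDefined_iff`) and in which gen-2's `factorMap` of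
`Cor312SettingDHVol` lands:

* `factorCoords`, `latticeF c = factorCoords(Π_{v⃗} c·I_{v⃗})`, `preimage_latticeF_comparison` (`= latticePk c`);
* `latticeF c` is BOUNDED, coordinatewise (`exists_norm_le_of_mem_latticeF`; campaign-S `isCompact_imageLogPacket`)
  — the input `hb` of c312-7's `hullDefined_of_stable`; and for `c ≠ 0` a NEIGHBOURHOOD OF `0`
  (`exists_ball_subset_latticeF`), whence ABSORPTION: every coordinatewise-bounded set — e.g. a bounded family of
  Θ-boxes, Dupuy–Hilado (4.10) — lies in some `latticeF c` (`exists_latticeF_of_norm_le`);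
* UNRAMIFIED CASE ([IUTchIV] Thm. 1.10 Step (vi), p. 29: "the “container of possible images” is precisely
  equal to the tensor product of log-shells"): for `p > 2`, `j ≥ 1` and every `K_v`, `v | p`, absolutely
  unramified, `Π_{v⃗} I_{v⃗} = Π_{v⃗} (R_{v⃗})^∼` (c312-3's `inv_two_p_pow_smul_logPacket_eq_normalizedPacket`), so
  `latticeF 1` IS the unit polydisc `hullSet (fun _ => 1)` (a hull-set) and `Π_{v⃗} (R_{v⃗})^∼` has weighted log-volume `0`.
[claim: Mochizuki2012, status: disputed] for the quoted sentences; [cite: DupuyHilado2025, §4 (intro), §4.10];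
[cite: Mochizuki2012, IUTchIV Prop. 1.4 (i) p. 13, Thm 1.10 proof Step (vi) p. 29]. Deliberately NOT here:
Θ-boxes, the `Cor312.Setting` (companion `Cor312ThetaFiniteDHVol` over c312-5's `Real.settingDHVol`), judgement.
-/

noncomputable section

open Set Function PiTensorProduct Bornology
open scoped TensorProduct Pointwise

namespace Summit.ABC

namespace IUTFork

namespace Cor312Vol

open Thm311 Literature.IUT.LogThetaLattice Literature.IUT.LogVolume Literature.LinearAlgebra.BaseChange

variable {T : ThetaIndex}

namespace PadicPresentation

variable {L : LogShells T} {vQ : T.VQ} {p : ℕ} [hp : Fact p.Prime] (P : PadicPresentation L vQ p)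

/-! ## 1. Field-factor coordinates `Π_{(v⃗,i)} L_{v⃗,i}`: the lattices are bounded neighbourhoods of `0` -/

section Factors

variable {j : T.Label}

/-- **Field-factor coordinates** of a summand family: `y ↦ (ψ_{v⃗}(y_{v⃗})_i)_{(v⃗,i)}` through abc-iut-c312-3's
chosen decompositions `ψ_{v⃗} : X_{v⃗} ≃ Π_i L_{v⃗,i}` ([IUTchIV] Prop. 1.4 (i): the tensor packet "decomposes … as
direct sums of finitely many finite extensions of `ℚ_p`"). Composed with the comparison this is gen-2's
`factorMap` of `Cor312SettingDHVol`. [cite: Mochizuki2012, IUTchIV Prop. 1.4 (i) p. 13] -/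
def factorCoords (j : T.Label) (y : ∀ e : T.Caps j → T.Fibre vQ, P.X e)
    (s : Σ e : T.Caps j → T.Fibre vQ, DIdx p (P.kk e)) : DFac p (P.kk s.1) s.2 :=
  dEquiv p (P.kk s.1) (y s.1) s.2

/-- Field-factor coordinates determine the family. [folklore] -/
theorem factorCoords_injective (j : T.Label) : Function.Injective (P.factorCoords j) := by
  intro y y' h
  funext e
  apply (dEquiv p (P.kk e)).injective
  funext i
  exact congrFun h ⟨e, i⟩

/-- Every coordinate family arises. [folklore] -/
theorem factorCoords_surjective (j : T.Label) : Function.Surjective (P.factorCoords j) := by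
  intro z
  refine ⟨fun e => (dEquiv p (P.kk e)).symm fun i => z ⟨e, i⟩, funext fun s => ?_⟩
  obtain ⟨e, i⟩ := s
  simp [factorCoords]

/-- Field-factor coordinates commute with the `ℚ_p`-scalars. [folklore] -/
theorem factorCoords_smul (j : T.Label) (a : ℚ_[p]) (y : ∀ e : T.Caps j → T.Fibre vQ, P.X e) :
    P.factorCoords j (a • y) = a • P.factorCoords j y := by
  funext s
  obtain ⟨e, i⟩ := s
  simp [factorCoords, map_smul]

/-- **The lattice `Π_{v⃗} c·I_{v⃗}` in field-factor coordinates.** [cite: DupuyHilado2025, §4 (intro)] -/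
def latticeF (j : T.Label) (c : ℚ_[p]) :
    Set (∀ s : (Σ e : T.Caps j → T.Fibre vQ, DIdx p (P.kk e)), DFac p (P.kk s.1) s.2) :=
  P.factorCoords j '' P.summandLattice j c

/-- Membership in `latticeF c`: every `v⃗`-block of coordinates lies in `ψ_{v⃗}(c·I_{v⃗})`. [folklore] -/
theorem mem_latticeF_iff (c : ℚ_[p])
    (z : ∀ s : (Σ e : T.Caps j → T.Fibre vQ, DIdx p (P.kk e)), DFac p (P.kk s.1) s.2) :
    z ∈ P.latticeF j c ↔ ∀ e, (fun i => z ⟨e, i⟩) ∈ dEquiv p (P.kk e) '' (c • logShell p (P.kk e)) := by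
  constructor
  · rintro ⟨y, hy, rfl⟩ e
    exact ⟨y e, (P.mem_summandLattice_iff c y).1 hy e, rfl⟩
  · intro h
    choose w hw hwz using h
    refine ⟨w, (P.mem_summandLattice_iff c w).2 hw, funext fun s => ?_⟩
    obtain ⟨e, i⟩ := s
    exact congrFun (hwz e) i

/-- `latticeF c` pulls back to `summandLattice c`. [folklore] -/
theorem preimage_latticeF (c : ℚ_[p]) : P.factorCoords j ⁻¹' P.latticeF j c = P.summandLattice j c :=
  (P.factorCoords_injective j).preimage_image _

/-- `latticeF c` pulls back along `factorCoords ∘ e` (gen-2's `factorMap`) to `latticePk c`. [folklore] -/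
theorem preimage_latticeF_comparison (c : ℚ_[p]) :
    (fun x => P.factorCoords j (P.comparison j x)) ⁻¹' P.latticeF j c = P.latticePk j c := by
  show P.comparison j ⁻¹' (P.factorCoords j ⁻¹' P.latticeF j c) = _
  rw [preimage_latticeF]
  rfl

/-- … and `latticePk c` maps ONTO `latticeF c` (the comparison is onto). [folklore] -/
theorem image_latticePk (c : ℚ_[p]) :
    (fun x => P.factorCoords j (P.comparison j x)) '' P.latticePk j c = P.latticeF j c := by
  show (P.factorCoords j ∘ P.comparison j) '' _ = _
  rw [Set.image_comp, latticePk, Set.image_preimage_eq _ (P.comparison_surjective j)]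
  rfl

/-- Scaling: `a·latticeF c ⊆ latticeF (a·c)` (pointwise). [folklore] -/
theorem smul_mem_latticeF {c : ℚ_[p]}
    {z : ∀ s : (Σ e : T.Caps j → T.Fibre vQ, DIdx p (P.kk e)), DFac p (P.kk s.1) s.2}
    (hz : z ∈ P.latticeF j c) (a : ℚ_[p]) : a • z ∈ P.latticeF j (a * c) := by
  rw [mem_latticeF_iff] at hz ⊢
  intro e
  obtain ⟨w, hw, hwz⟩ := hz e
  refine ⟨a • w, ?_, ?_⟩
  · rw [← smul_smul]
    exact Set.smul_mem_smul_set hw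
  · rw [map_smul, hwz]
    rfl

/-- `ψ_{v⃗}(c·I_{v⃗})` is COMPACT (campaign-S `isCompact_imageLogPacket`: `ψ(log_p(R_I^×))` is a compact open
subgroup). [cite: DupuyHilado2025, §4 (intro)] -/
theorem isCompact_image_smul_logShell (e : T.Caps j → T.Fibre vQ) (c : ℚ_[p]) :
    IsCompact (dEquiv p (P.kk e) '' (c • logShell p (P.kk e))) := by
  haveI : Nonempty (T.Caps j) := ⟨0⟩
  unfold logShell
  rw [smul_smul, image_smul_setₛₗ, ← coe_imageLogPacket]
  exact (isCompact_imageLogPacket p (P.kk e)).smul _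

/-- `ψ_{v⃗}(c·I_{v⃗})` is OPEN for `c ≠ 0`. [cite: DupuyHilado2025, §4 (intro)] -/
theorem isOpen_image_smul_logShell (e : T.Caps j → T.Fibre vQ) {c : ℚ_[p]} (hc : c ≠ 0) :
    IsOpen (dEquiv p (P.kk e) '' (c • logShell p (P.kk e))) := by
  haveI : Nonempty (T.Caps j) := ⟨0⟩
  unfold logShell
  rw [smul_smul, image_smul_setₛₗ, ← coe_imageLogPacket]
  exact (isOpen_imageLogPacket p (P.kk e)).smul₀ (mul_ne_zero hc (shellScalar_ne_zero p))

/-- `0 ∈ ψ_{v⃗}(c·I_{v⃗})`. [folklore] -/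
theorem zero_mem_image_smul_logShell (e : T.Caps j → T.Fibre vQ) (c : ℚ_[p]) :
    (0 : DSum p (P.kk e)) ∈ dEquiv p (P.kk e) '' (c • logShell p (P.kk e)) := by
  refine ⟨0, ?_, map_zero _⟩
  have h : (0 : P.X e) ∈ logShell p (P.kk e) := by
    refine ⟨0, (logPacket p (P.kk e)).zero_mem, ?_⟩
    exact smul_zero _
  simpa using Set.smul_mem_smul_set (a := c) h

/-- **`latticeF c` is BOUNDED** (coordinatewise: a uniform bound on all coordinates; the consumer's
`Bornology.IsBounded` follows by `pi_norm_le_iff_of_nonneg`). [cite: DupuyHilado2025, §4 (intro)] -/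
theorem exists_norm_le_of_mem_latticeF (c : ℚ_[p]) :
    ∃ R : ℝ, 0 ≤ R ∧ ∀ z ∈ P.latticeF j c, ∀ s, ‖z s‖ ≤ R := by
  classical
  haveI : Fintype (T.Caps j → T.Fibre vQ) := Fintype.ofFinite _
  have h := fun e : T.Caps j → T.Fibre vQ =>
    isBounded_iff_forall_norm_le.1 (P.isCompact_image_smul_logShell e c).isBounded
  choose C hC using h
  refine ⟨∑ e, |C e|, Finset.sum_nonneg fun e _ => abs_nonneg (C e), fun z hz s => ?_⟩
  obtain ⟨e, i⟩ := s
  have hz' := (P.mem_latticeF_iff c z).1 hz e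
  have h1 : ‖(fun i => z ⟨e, i⟩ : DSum p (P.kk e)) i‖ ≤ ‖(fun i => z ⟨e, i⟩ : DSum p (P.kk e))‖ :=
    norm_le_pi_norm (fun i => z ⟨e, i⟩ : DSum p (P.kk e)) i
  calc ‖z ⟨e, i⟩‖ = ‖(fun i => z ⟨e, i⟩ : DSum p (P.kk e)) i‖ := rfl
    _ ≤ ‖(fun i => z ⟨e, i⟩ : DSum p (P.kk e))‖ := h1
    _ ≤ C e := hC e _ hz'
    _ ≤ |C e| := le_abs_self _
    _ ≤ ∑ e', |C e'| := Finset.single_le_sum (fun e' _ => abs_nonneg (C e')) (Finset.mem_univ e)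

/-- **`latticeF c` is a NEIGHBOURHOOD OF `0`** for `c ≠ 0` (it contains a coordinate ball).
[cite: DupuyHilado2025, §4 (intro)] -/
theorem exists_ball_subset_latticeF {c : ℚ_[p]} (hc : c ≠ 0) :
    ∃ r : ℝ, 0 < r ∧ ∀ z : (∀ s : (Σ e : T.Caps j → T.Fibre vQ, DIdx p (P.kk e)), DFac p (P.kk s.1) s.2),
      (∀ s, ‖z s‖ < r) → z ∈ P.latticeF j c := by
  classical
  haveI : Fintype (T.Caps j → T.Fibre vQ) := Fintype.ofFinite _
  haveI : Nonempty (T.Fibre vQ) := by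
    obtain ⟨v, hv⟩ := T.fibre_nonempty vQ
    exact ⟨⟨v, hv⟩⟩
  have hr : ∀ e : T.Caps j → T.Fibre vQ, ∃ r > 0,
      Metric.ball (0 : DSum p (P.kk e)) r ⊆ dEquiv p (P.kk e) '' (c • logShell p (P.kk e)) :=
    fun e => Metric.isOpen_iff.1 (P.isOpen_image_smul_logShell e hc) 0 (P.zero_mem_image_smul_logShell e c)
  choose r hr0 hr using hr
  refine ⟨Finset.univ.inf' Finset.univ_nonempty r, (Finset.lt_inf'_iff _).2 fun e _ => hr0 e,
    fun z hz => ?_⟩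
  rw [mem_latticeF_iff]
  intro e
  apply hr e
  rw [Metric.mem_ball, dist_zero_right]
  exact (pi_norm_lt_iff (hr0 e)).2 fun i =>
    lt_of_lt_of_le (hz ⟨e, i⟩) (Finset.inf'_le _ (Finset.mem_univ e))

/-- **ABSORPTION: every coordinatewise-bounded set lies in some lattice `latticeF c`, `c ≠ 0`** (a bounded
set of a normed `ℚ_p`-space is absorbed by any neighbourhood of `0`) — how a BOUNDED family of Θ-boxes
(Dupuy–Hilado (4.10)) enters the lattice mechanism. [cite: DupuyHilado2025, §4.10] -/
theorem exists_latticeF_of_norm_le (R : ℝ) :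
    ∃ c : ℚ_[p], c ≠ 0 ∧ ∀ z : (∀ s : (Σ e : T.Caps j → T.Fibre vQ, DIdx p (P.kk e)), DFac p (P.kk s.1) s.2),
      (∀ s, ‖z s‖ ≤ R) → z ∈ P.latticeF j c := by
  obtain ⟨r, hr0, hr⟩ := P.exists_ball_subset_latticeF (j := j) (one_ne_zero : (1 : ℚ_[p]) ≠ 0)
  obtain ⟨a, ha⟩ := NormedField.exists_lt_norm ℚ_[p] (max R 0 / r)
  have ha0 : 0 < ‖a‖ := lt_of_le_of_lt (div_nonneg (le_max_right R 0) hr0.le) ha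
  have ha0' : a ≠ 0 := norm_pos_iff.1 ha0
  refine ⟨a * 1, by rw [mul_one]; exact ha0', fun z hz => ?_⟩
  have hz' : a⁻¹ • z ∈ P.latticeF j 1 := by
    refine hr _ fun s => ?_
    rw [Pi.smul_apply, norm_smul, norm_inv]
    have h1 : ‖z s‖ ≤ max R 0 := (hz s).trans (le_max_left R 0)
    have h2 : max R 0 < r * ‖a‖ := (div_lt_iff₀ hr0).1 ha |>.trans_eq (mul_comm _ _)
    calc ‖a‖⁻¹ * ‖z s‖ ≤ ‖a‖⁻¹ * max R 0 := mul_le_mul_of_nonneg_left h1 (inv_nonneg.2 ha0.le)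
      _ < ‖a‖⁻¹ * (r * ‖a‖) := mul_lt_mul_of_pos_left h2 (inv_pos.2 ha0)
      _ = r := by field_simp
  have h := P.smul_mem_latticeF hz' a
  rwa [smul_inv_smul₀ ha0'] at h

end Factors

/-! ## 2. The unramified case: the lattice IS the unit polydisc, of log-volume `0` -/

section Unramified

variable {j : T.Label}

/-- `latticePk c`, `c ≠ 0`, is ADMISSIBLE in the verbatim container (a direct product over the summands of
the positive-finite-measure sets `c·I_{v⃗}`). [cite: DupuyHilado2025, §4 (intro)] -/
theorem adm_latticePk {c : ℚ_[p]} (hc : c ≠ 0) : P.toLocalPieces.Adm j (P.latticePk j c) := by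
  haveI : Nonempty (T.Caps j) := ⟨0⟩
  exact ⟨fun e => c • logShell p (P.kk e), Set.image_preimage_eq _ (P.comparison_surjective j),
    fun e => packetAdm_const_smul p (P.kk e) hc (packetAdm_logShell p (P.kk e))⟩

/-- **At an odd prime with every `K_v`, `v | p`, absolutely unramified, `Π_{v⃗} I_{v⃗} = Π_{v⃗} (R_{v⃗})^∼`** for
`j ≥ 1` (abc-iut-c312-3's `inv_two_p_pow_smul_logPacket_eq_normalizedPacket`: `(2p)^{−(j+1)}·log_p(R^×) = (R)^∼`;
[IUTchIV] Thm. 1.10 Step (vi): "the “container of possible images” is precisely equal to the tensor product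
of log-shells"). [cite: Mochizuki2012, IUTchIV Thm 1.10 proof Step (vi) p. 29] -/
theorem summandLattice_one_eq_of_unramified (hp2 : 2 < p) (hj : 2 ≤ Fintype.card (T.Caps j))
    (he : ∀ v : T.Fibre vQ, absRamificationIdx p (P.k v) = 1) :
    P.summandLattice j 1 = Set.pi univ fun e => (normalizedPacket p (P.kk e) : Set (P.X e)) := by
  unfold summandLattice
  refine congrArg (Set.pi univ) (funext fun e => ?_)
  rw [one_smul]
  exact inv_two_p_pow_smul_logPacket_eq_normalizedPacket p (P.kk e) hj hp2 fun a => he (e a)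

/-- … so `latticePk 1 = e⁻¹(Π_{v⃗} (R_{v⃗})^∼)`. [cite: Mochizuki2012, IUTchIV Thm 1.10 proof Step (vi) p. 29] -/
theorem latticePk_one_eq_of_unramified (hp2 : 2 < p) (hj : 2 ≤ Fintype.card (T.Caps j))
    (he : ∀ v : T.Fibre vQ, absRamificationIdx p (P.k v) = 1) :
    P.latticePk j 1 = P.comparison j ⁻¹' Set.pi univ fun e => (normalizedPacket p (P.kk e) : Set (P.X e)) := by
  unfold latticePk
  rw [P.summandLattice_one_eq_of_unramified hp2 hj he]

/-- **… and `latticeF 1` is the UNIT POLYDISC `𝒪_L = hullSet 1`** of the field-factor coordinates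
(`ψ_{v⃗}((R_{v⃗})^∼) = Π_i 𝒪_{L_{v⃗,i}}`, campaign-S `image_normalizedPacket_eq_coe`) — a hull-set.
[cite: Mochizuki2012, IUTchIV Prop. 1.4 (i) p. 13] -/
theorem latticeF_one_eq_hullSet_of_unramified (hp2 : 2 < p) (hj : 2 ≤ Fintype.card (T.Caps j))
    (he : ∀ v : T.Fibre vQ, absRamificationIdx p (P.k v) = 1) :
    P.latticeF j 1 =
      hullSet (fun s : (Σ e : T.Caps j → T.Fibre vQ, DIdx p (P.kk e)) => DFac p (P.kk s.1) s.2) (fun _ => 1) := by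
  haveI : Nonempty (T.Caps j) := ⟨0⟩
  ext z
  rw [mem_latticeF_iff, hullSet, mem_polydisc]
  have key : ∀ e : T.Caps j → T.Fibre vQ, ((fun i => z ⟨e, i⟩) ∈
      dEquiv p (P.kk e) '' ((1 : ℚ_[p]) • logShell p (P.kk e))) ↔ ∀ i, ‖z ⟨e, i⟩‖ ≤ 1 := by
    intro e
    have hI : (1 : ℚ_[p]) • logShell p (P.kk e) = (normalizedPacket p (P.kk e) : Set (P.X e)) := by
      rw [one_smul]
      exact inv_two_p_pow_smul_logPacket_eq_normalizedPacket p (P.kk e) hj hp2 fun a => he (e a)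
    rw [hI, image_normalizedPacket_eq_coe, coe_piUnitBallStructure]
    exact mem_polydisc _
  constructor
  · intro h s
    obtain ⟨e, i⟩ := s
    dsimp only
    rw [norm_one]
    exact (key e).1 (h e) i
  · intro h e
    refine (key e).2 fun i => ?_
    have h2 := h ⟨e, i⟩
    dsimp only at h2
    rw [norm_one] at h2
    exact h2

/-- The weighted log-volume of `Π_{v⃗} (R_{v⃗})^∼` vanishes (normalisation `log μ̄((R)^∼) = 0`, Dupuy–Hilado (3.6)),
for any summation instance. [cite: DupuyHilado2025, Def. 3.6.1] -/
theorem sum_w_mul_packetLogμ_normalizedPacket [Fintype (T.Caps j → T.Fibre vQ)] :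
    ∑ e : T.Caps j → T.Fibre vQ, P.w j e * packetLogμ p (P.kk e) (normalizedPacket p (P.kk e)) = 0 := by
  haveI : Nonempty (T.Caps j) := ⟨0⟩
  exact Finset.sum_eq_zero fun e _ => by rw [packetLogμ_normalizedPacket, mul_zero]

/-- `(R_{v⃗})^∼` is admissible in every summand. [cite: DupuyHilado2025, Def. 3.6.1] -/
theorem packetAdm_normalizedPacket_kk (e : T.Caps j → T.Fibre vQ) :
    PacketAdm p (P.kk e) (normalizedPacket p (P.kk e)) := by
  haveI : Nonempty (T.Caps j) := ⟨0⟩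
  exact packetAdm_normalizedPacket p (P.kk e)

end Unramified

end PadicPresentation

end Cor312Vol

end IUTFork

end Summit.ABC

end
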